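import Literature.NumberTheory.Sieve.DrappeauDispersionProp53Tools
import Literature.NumberTheory.Sieve.DrappeauDispersionSquarefreeReduction
import HarnessLib

/-!
# Drappeau 2017, Proposition 5.3 from the estimate for `𝒮₁` (the apex-free assembly of §5.3–§5.6)

Topic `Literature/NumberTheory/Sieve`, part of the formalisation of §5 of S. Drappeau, *Sums of
Kloosterman sums in arithmetic progressions, and the error term in the dispersion method*, Proc. London
Math. Soc. (3) 114 (2017) 684–732 = arXiv:1504.05549 (Theorem 5.1 = the named fact
`Literature.NumberTheory.Sieve.Drappeau2017_theorem51`).  Everything here is PROVED; no definition and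
no named fact is introduced.

§5.3 of the paper ("Applying the dispersion method", arXiv p. 18): with a smooth majorant `α(m)` of
`1_{m∼M}`, Cauchy–Schwarz gives (5.10) `|𝒟|² ≪ (log x)^{O(1)} M (𝒮₁ − 2Re 𝒮₂ + 𝒮₃)` and the goal
(5.11) `𝒮₁ − 2Re 𝒮₂ + 𝒮₃ = O((log x)^{O(1)} M N² R^{−2})`; then (5.16) `𝒮₃ = α̂(0)X₃ + O(MN²x^{−1/2})`,
(5.19) `𝒮₂ = α̂(0)X₂ + O(MN²R^{−2})`, `X₂ = X₃`, §5.6 `X₁ − X₃ ≪ (log x)^{O(1)}(N + N²R^{−2})`, and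
§5.4–5.5 `𝒮₁ = α̂(0)X₁ + O(MN²R^{−2})` — the last through the paper's Theorem 2.1 (sums of Kloosterman
sums with congruence conditions), which is the one input NOT formalised in this tree.

`Drappeau2017.prop53_of_S1` proves: **if** `|𝒮₁ − α̂(0)X₁| ≤ C M N² (log x)^{c} Rd^{−2}` under the
hypotheses of Theorem 5.1 (for the concrete weights of the tree: moduli weight `γ = BFI.bump S Y`, majorant
`α = BFI.bump M (M/2)`, `α̂(0)` replaced by `A₀ = ∑_m α(m)`), **then** Proposition 5.3 holds in the form
required by `Drappeau2017_theorem51_of_smooth_sqfree` (`DrappeauDispersionSquarefreeReduction`), so that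
Theorem 5.1 follows (`Drappeau2017_theorem51_of_S1`).  The proof is the assembly of the landed bricks:
`smoothSum_eq_dispSum` + `norm_dispSum_sq_le_four_terms` (`DrappeauDispersionAssembly`) +
`norm_dispS3_sub_mul_mainX3_le'`/`norm_dispS2_sub_mul_mainX3_le'` with `completion_pair_bump_le` /
`completion_class_bump_le` (`Λ = x^{1/40}`, `n = 121`) and `sum_pairs_S3_weights_le` /
`sum_pairs_S2_weights_le`, `norm_mainTermsDiff_le` (`DrappeauDispersionMainTermsBound`), the divisor
moments of `DivisorPowerSums`, and the absorption of `(log x)^{O(1)}` by the power savings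
`M ≥ x^{2/3−δ} ≥ R⁵ΛQ…` (δ ≤ 1/100`, `δ ≤ η/2` for the main terms since `R² ≤ x^{2δ} ≤ N`).

## References

* S. Drappeau, Proc. London Math. Soc. (3) 114 (2017) 684–732, arXiv:1504.05549, §5.3 (5.9)–(5.19),
  §5.6, Proposition 5.3. [cite: Drappeau2017, §5.3 Prop. 5.3]
-/

noncomputable section

open Finset Real
open scoped ArithmeticFunction.sigma

namespace Literature.NumberTheory.Sieve

namespace Drappeau2017

/-! ### Absorbing powers of `log x` -/

/-- For `κ > 0`, `c ∈ ℕ` and any `C`, `C (log x)^c ≤ x^κ` for all large `x`. [folklore] -/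
theorem exists_mul_log_pow_le_rpow (C : ℝ) (c : ℕ) {κ : ℝ} (hκ : 0 < κ) :
    ∃ x₀ : ℝ, ∀ x : ℝ, x₀ ≤ x → C * Real.log x ^ c ≤ x ^ κ := by
  set ε : ℝ := κ / (c + 1) with hε
  have hε0 : 0 < ε := by positivity
  -- threshold: `x ≥ 1` and `|C| ε^{-c} ≤ x^ε`
  refine ⟨max 1 ((|C| / ε ^ c) ^ (1 / ε)), fun x hx => ?_⟩
  have hx1 : 1 ≤ x := le_trans (le_max_left _ _) hx
  have hx0 : 0 < x := by linarith
  have hlog0 : 0 ≤ Real.log x := Real.log_nonneg hx1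
  have hlog : Real.log x ≤ x ^ ε / ε := Real.log_le_rpow_div hx0.le hε0
  have h1 : Real.log x ^ c ≤ (x ^ ε / ε) ^ c := pow_le_pow_left₀ hlog0 hlog c
  have h2 : (x ^ ε / ε) ^ c = x ^ (ε * c) / ε ^ c := by
    rw [div_pow, ← Real.rpow_natCast, ← Real.rpow_mul hx0.le]
  have h3 : |C| / ε ^ c ≤ x ^ ε := by
    have hb : 0 ≤ |C| / ε ^ c := by positivity
    calc |C| / ε ^ c = ((|C| / ε ^ c) ^ (1 / ε)) ^ ε := by
          rw [← Real.rpow_mul hb, one_div_mul_cancel hε0.ne', Real.rpow_one]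
      _ ≤ x ^ ε := Real.rpow_le_rpow (by positivity) (le_trans (le_max_right _ _) hx) hε0.le
  have hκε : ε * c + ε = κ := by rw [hε]; field_simp
  calc C * Real.log x ^ c ≤ |C| * Real.log x ^ c :=
        mul_le_mul_of_nonneg_right (le_abs_self C) (pow_nonneg hlog0 c)
    _ ≤ |C| * (x ^ (ε * c) / ε ^ c) := by rw [← h2]; exact mul_le_mul_of_nonneg_left h1 (abs_nonneg C)
    _ = (|C| / ε ^ c) * x ^ (ε * c) := by ring
    _ ≤ x ^ ε * x ^ (ε * c) := mul_le_mul_of_nonneg_right h3 (by positivity)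
    _ = x ^ κ := by rw [← Real.rpow_add hx0, add_comm, hκε]

/-! ### Proposition 5.3 from the `𝒮₁`-estimate -/

/-- Bookkeeping for (5.10): `F (t₁ + 2t₂ + t₃ + A t₄) ≤ B₀ (B₁ + 2B₂ + B₃ + B₄)` termwise.
[folklore] -/
theorem bracket_le_aux {F t₁ t₂ t₃ t₄ A B₀ B₁ B₂ B₃ B₄ : ℝ} (hF : F ≤ B₀) (hF0 : 0 ≤ F)
    (h₁ : t₁ ≤ B₁) (h₂ : t₂ ≤ B₂) (h₃ : t₃ ≤ B₃) (h₄ : A * t₄ ≤ B₄) (ht₁ : 0 ≤ t₁) (ht₂ : 0 ≤ t₂)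
    (ht₃ : 0 ≤ t₃) (ht₄ : 0 ≤ A * t₄) :
    F * (t₁ + 2 * t₂ + t₃ + A * t₄) ≤ B₀ * (B₁ + 2 * B₂ + B₃ + B₄) :=
  mul_le_mul hF (by linarith) (by positivity) (hF0.trans hF)

set_option maxHeartbeats 4000000 in
/-- **Drappeau 2017, Proposition 5.3 (for the weights `BFI.bump`), from an estimate for `𝒮₁`.**
Suppose that for every `η > 0` there is `δ > 0` such that for every `A ≥ 0` there are `C, c, x₀` with:
for `x ≥ x₀`, data `M N = x`, `x^η ≤ N ≤ S^{2/3−η}`, `x^{1/4} ≤ S ≤ x^{1/2+δ}`, `1 ≤ Rd ≤ x^δ`,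
`S x^{−δ} ≤ Y ≤ S/4`, `0 < |aᵢ| ≤ x^δ`, and every `β` with `|β_n| ≤ τ(n)^A` supported on squarefree `n`,
`|𝒮₁ − A₀ X₁| ≤ C M N² (log x)^c / Rd²`, where `𝒮₁ = dispS1` and `X₁ = mainX1` are taken for the moduli
`{1 ≤ q ≤ 2S+Y}` with weight `γ = BFI.bump S Y`, the `n`-range `n ∼ N`, the `m`-range `BFI.mRange M (M/2)`
with the smooth majorant `α = BFI.bump M (M/2)`, and `A₀ = ∑_m α(m)` (the paper's `α̂(0)`).  Then the
smoothed statement of Proposition 5.3 holds: for every `η > 0` there is `δ > 0` such that for every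
`A ≥ 0` there are `C', c', x₀'` with
`|∑_{(q,a₁a₂)=1} γ(q) ∑_{m∼M} ∑_{n∼N,(n,a₂)=1} α_m β_n 𝔲_R(mn ā₁ a₂; q)| ≤ C' x (log x)^{c'} / Rd`
for all such data and all `|α_m| ≤ τ(m)^A` (the hypothesis of `Drappeau2017_theorem51_of_smooth_sqfree`).
This is §5.3 + §5.6 of the paper assembled: (5.10) Cauchy–Schwarz, (5.16), (5.19), (5.21) and the
hypothesis for `𝒮₁`, with `δ = min(δ_{𝒮₁}, η/2, 1/100)`. [cite: Drappeau2017, §5.3 Prop. 5.3] -/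
theorem prop53_of_S1
    (HS1 : ∀ η : ℝ, 0 < η → ∃ δ : ℝ, 0 < δ ∧ ∀ Aτ : ℝ, 0 ≤ Aτ → ∃ C c₀ x₀ : ℝ, ∀ x : ℝ, x₀ ≤ x →
      ∀ M N S Rd Y : ℝ, M * N = x → x ^ η ≤ N → N ≤ S ^ (2 / 3 - η) → x ^ (1 / 4 : ℝ) ≤ S →
        S ≤ x ^ (1 / 2 + δ) → 1 ≤ Rd → Rd ≤ x ^ δ → S * x ^ (-δ) ≤ Y → Y ≤ S / 4 →
      ∀ a₁ a₂ : ℤ, a₁ ≠ 0 → a₂ ≠ 0 → (|a₁| : ℝ) ≤ x ^ δ → (|a₂| : ℝ) ≤ x ^ δ →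
      ∀ β : ℕ → ℂ, (∀ n, ‖β n‖ ≤ (σ 0 n : ℝ) ^ Aτ) → (∀ n, ¬Squarefree n → β n = 0) →
        ‖dispS1 a₁ a₂ ((BFI.mRange S Y).filter (fun q : ℕ => 0 < q)) (BFI.mRange M (M / 2))
              (BFI.dyadic N) (fun q : ℕ => BFI.bump S Y q) (fun m : ℕ => BFI.bump M (M / 2) m) β -
            ((∑ m ∈ BFI.mRange M (M / 2), BFI.bump M (M / 2) m : ℝ) : ℂ) *
              mainX1 a₁ a₂ ((BFI.mRange S Y).filter (fun q : ℕ => 0 < q)) (BFI.dyadic N)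
                (fun q : ℕ => BFI.bump S Y q) β‖ ≤
          C * M * N ^ 2 * Real.log x ^ c₀ / Rd ^ 2) :
    ∀ η : ℝ, 0 < η → ∃ δ : ℝ, 0 < δ ∧ ∀ Aτ : ℝ, 0 ≤ Aτ → ∃ C c₀ x₀ : ℝ, ∀ x : ℝ, x₀ ≤ x →
      ∀ M N S Rd Y : ℝ, M * N = x → x ^ η ≤ N → N ≤ S ^ (2 / 3 - η) → x ^ (1 / 4 : ℝ) ≤ S →
        S ≤ x ^ (1 / 2 + δ) → 1 ≤ Rd → Rd ≤ x ^ δ → S * x ^ (-δ) ≤ Y → Y ≤ S / 4 →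
      ∀ a₁ a₂ : ℤ, a₁ ≠ 0 → a₂ ≠ 0 → (|a₁| : ℝ) ≤ x ^ δ → (|a₂| : ℝ) ≤ x ^ δ →
      ∀ α β : ℕ → ℂ, (∀ m, ‖α m‖ ≤ (σ 0 m : ℝ) ^ Aτ) → (∀ n, ‖β n‖ ≤ (σ 0 n : ℝ) ^ Aτ) →
        (∀ n, ¬Squarefree n → β n = 0) →
        ‖∑ s ∈ (BFI.mRange S Y).filter (fun s : ℕ => IsCoprime (s : ℤ) (a₁ * a₂)),
            ((BFI.bump S Y s : ℝ) : ℂ) *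
              ∑ m ∈ BFI.dyadic M, ∑ n ∈ (BFI.dyadic N).filter (fun n : ℕ => IsCoprime (n : ℤ) a₂),
                α m * β n *
                  uR Rd s (((m * n : ℕ) : ZMod s) * ((a₁ : ZMod s))⁻¹ * ((a₂ : ZMod s)))‖ ≤
          C * x * Real.log x ^ c₀ / Rd := by
  intro η hη
  obtain ⟨δ₁, hδ₁, Hδ⟩ := HS1 η hη
  set δ : ℝ := min δ₁ (min (η / 2) (1 / 100)) with hδdef
  have hδ0 : 0 < δ := lt_min hδ₁ (lt_min (by positivity) (by norm_num))
  have hδ₁' : δ ≤ δ₁ := min_le_left _ _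
  have hδη : δ ≤ η / 2 := (min_le_right _ _).trans (min_le_left _ _)
  have hδ1 : δ ≤ 1 / 100 := (min_le_right _ _).trans (min_le_right _ _)
  refine ⟨δ, hδ0, fun Aτ hAτ => ?_⟩
  obtain ⟨C₁, c₁, x₁, HC1⟩ := Hδ Aτ hAτ
  -- divisor moments and the Poisson parameters
  set r : ℕ := ⌈2 * Aτ⌉₊ with hrdef
  have hr : 2 * Aτ ≤ r := Nat.le_ceil _
  have hrA : Aτ ≤ r := by linarith
  obtain ⟨Cd, hCd, hCdle⟩ := exists_sum_sigma_zero_pow_le_real r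
  obtain ⟨Cq, hCq, hCqle⟩ := exists_sum_sigma_zero_pow_div_le_real 4
  set cd : ℕ := 2 ^ (r + 1) with hcddef
  obtain ⟨n₀, hn₀2, hn₀eq⟩ : ∃ n : ℕ, 2 ≤ n ∧ (1 / 40 : ℝ) * ((n : ℝ) - 1) = 3 :=
    ⟨121, by norm_num, by norm_num⟩
  have hK0 : 0 ≤ BFI.derivConst n₀ := zero_le_one.trans (BFI.one_le_derivConst n₀)
  set cT : ℝ := 2 ^ (n₀ + 3) * BFI.derivConst n₀ with hcTdef
  have hcT0 : 0 ≤ cT := mul_nonneg (pow_nonneg zero_le_two _) hK0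
  set CB : ℝ := Cd * 2 ^ (cd + 1) with hCBdef
  set CF : ℝ := Cd * (5 / 2) * 2 ^ cd with hCFdef
  set CQ : ℝ := Cq * 2 ^ 32 with hCQdef
  have hCB0 : 0 < CB := by positivity
  have hCF0 : 0 < CF := by positivity
  have hCQ0 : 0 < CQ := by positivity
  obtain ⟨x₃, hx₃⟩ := exists_mul_log_pow_le_rpow ((8 + cT) * CB ^ 2 * CQ ^ 2) (2 * cd + 64)
    (κ := 17 / 40) (by norm_num)
  obtain ⟨x₂, hx₂⟩ := exists_mul_log_pow_le_rpow (3 * (8 + cT) * CB ^ 2 * CQ) (2 * cd + 32)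
    (κ := 9 / 100) (by norm_num)
  set CS : ℝ := max C₁ 0 + 3 + 5346 * CB with hCSdef
  have hCS0 : 0 < CS := by have : 0 ≤ max C₁ 0 := le_max_right _ _; positivity
  set cS : ℝ := max (max c₁ 0) ((cd : ℝ) + 5) with hcSdef
  have hcS0 : 0 ≤ cS := le_trans (le_max_right _ _) (le_max_left _ _)
  have hcS1 : max c₁ 0 ≤ cS := le_max_left _ _
  have hcS2 : (cd : ℝ) + 5 ≤ cS := le_max_right _ _
  refine ⟨2 * Real.sqrt (CF * CS), ((cd : ℝ) + cS) / 2, max (max x₁ 9) (max x₂ x₃),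
    fun x hx M N S Rd Y hMN hN hNS hS hSx hRd1 hRd hY1 hY4 a₁ a₂ ha₁ ha₂ ha₁x ha₂x α β hα hβ hβs => ?_⟩
  -- ### sizes
  have hxx₁ : x₁ ≤ x := le_trans (le_trans (le_max_left _ _) (le_max_left _ _)) hx
  have hx9 : 9 ≤ x := le_trans (le_trans (le_max_right _ _) (le_max_left _ _)) hx
  have hxx₂ : x₂ ≤ x := le_trans (le_trans (le_max_left _ _) (le_max_right _ _)) hx
  have hxx₃ : x₃ ≤ x := le_trans (le_trans (le_max_right _ _) (le_max_right _ _)) hx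
  have hx1 : 1 ≤ x := by linarith
  have hx0 : 0 < x := by linarith
  set L : ℝ := Real.log x with hLdef
  have hL1 : 1 ≤ L := by
    rw [hLdef, Real.le_log_iff_exp_le (by linarith)]
    have := Real.exp_one_lt_d9
    linarith
  have hL0 : 0 < L := by linarith
  have hlog3 : Real.log 3 ≤ L := Real.log_le_log (by norm_num) (by linarith)
  have hlog2x : ∀ y : ℝ, 0 < y → y ≤ 3 * x → Real.log y ≤ 2 * L := by
    intro y hy hyx
    calc Real.log y ≤ Real.log (3 * x) := Real.log_le_log hy hyx
      _ = Real.log 3 + Real.log x := Real.log_mul (by norm_num) hx0.ne'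
      _ ≤ 2 * L := by rw [hLdef] at hlog3 ⊢; linarith
  have hN0 : 0 < N := lt_of_lt_of_le (Real.rpow_pos_of_pos hx0 η) hN
  have hM0 : 0 < M := by
    by_contra h
    have : M * N ≤ 0 := mul_nonpos_of_nonpos_of_nonneg (not_lt.1 h) hN0.le
    linarith
  have hS0 : 0 < S := lt_of_lt_of_le (Real.rpow_pos_of_pos hx0 _) hS
  have hS1 : 1 ≤ S := le_trans (Real.one_le_rpow hx1 (by norm_num)) hS
  have hRd0 : 0 < Rd := by linarith
  have hY0 : 0 < Y := lt_of_lt_of_le (mul_pos hS0 (Real.rpow_pos_of_pos hx0 _)) hY1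
  have hYS2 : Y ≤ S / 2 := by linarith
  have hYS : Y ≤ S := by linarith
  have hmono : ∀ {u v : ℝ}, u ≤ v → x ^ u ≤ x ^ v := fun h => Real.rpow_le_rpow_of_exponent_le hx1 h
  have hle1 : ∀ {u : ℝ}, u ≤ 1 → x ^ u ≤ x := fun h => (hmono h).trans_eq (Real.rpow_one x)
  have hN1 : 1 ≤ N := le_trans (Real.one_le_rpow hx1 hη.le) hN
  have hSx1 : S ≤ x := hSx.trans (hle1 (by linarith))
  have hNS23 : N ≤ S ^ (2 / 3 : ℝ) := hNS.trans (Real.rpow_le_rpow_of_exponent_le hS1 (by linarith))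
  have hNx34 : N ≤ x ^ (17 / 50 : ℝ) := by
    refine hNS23.trans ?_
    calc S ^ (2 / 3 : ℝ) ≤ (x ^ (1 / 2 + δ)) ^ (2 / 3 : ℝ) := Real.rpow_le_rpow hS0.le hSx (by norm_num)
      _ = x ^ ((1 / 2 + δ) * (2 / 3)) := by rw [← Real.rpow_mul hx0.le]
      _ ≤ x ^ (17 / 50 : ℝ) := hmono (by linarith)
  have hNx : N ≤ x := hNx34.trans (hle1 (by norm_num))
  have hM66 : x ^ (33 / 50 : ℝ) ≤ M := by
    -- `M = x / N ≥ x / x^{17/50}`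
    have hMeq : M = x / N := by field_simp; linarith
    rw [hMeq, le_div_iff₀ hN0]
    calc x ^ (33 / 50 : ℝ) * N ≤ x ^ (33 / 50 : ℝ) * x ^ (17 / 50 : ℝ) :=
          mul_le_mul_of_nonneg_left hNx34 (by positivity)
      _ = x := by rw [← Real.rpow_add hx0]; norm_num
  have hMhalf : x ^ (1 / 2 : ℝ) ≤ M := (hmono (by norm_num)).trans hM66
  have hM3 : 3 ≤ M := by
    have h1 : Real.sqrt x ≤ M := by rw [Real.sqrt_eq_rpow]; exact hMhalf
    have h2 : (3 : ℝ) ≤ Real.sqrt x := by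
      rw [show (3 : ℝ) = Real.sqrt 9 by rw [show (9:ℝ) = 3 ^ 2 by norm_num, Real.sqrt_sq (by norm_num)]]
      exact Real.sqrt_le_sqrt hx9
    linarith
  have hMx : M ≤ x := by
    calc M = M * 1 := (mul_one M).symm
      _ ≤ M * N := mul_le_mul_of_nonneg_left hN1 hM0.le
      _ = x := hMN
  -- the integer cut-off `R = ⌊Rd⌋`
  set R : ℕ := ⌊Rd⌋₊ with hRdef
  have hR1 : 1 ≤ R := Nat.le_floor (by simpa using hRd1)
  have hR0' : (0 : ℝ) < R := by exact_mod_cast hR1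
  have hR1' : (1 : ℝ) ≤ R := by exact_mod_cast hR1
  have hRRd : (R : ℝ) ≤ Rd := Nat.floor_le hRd0.le
  have hRd2R : Rd ≤ 2 * R := by
    have := Nat.lt_floor_add_one Rd
    rw [← hRdef] at this; linarith
  have hRx : (R : ℝ) ≤ x ^ δ := hRRd.trans hRd
  have hR100 : (R : ℝ) ≤ x ^ (1 / 100 : ℝ) := hRx.trans (hmono hδ1)
  -- `R² ≤ N` (main terms) : `R² ≤ x^{2δ} ≤ x^η ≤ N`
  have hR2N : (R : ℝ) ^ 2 ≤ N := by
    calc (R : ℝ) ^ 2 ≤ (x ^ δ) ^ 2 := pow_le_pow_left₀ hR0'.le hRx 2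
      _ = x ^ (2 * δ) := by rw [← Real.rpow_natCast, ← Real.rpow_mul hx0.le]; ring_nf
      _ ≤ x ^ η := hmono (by linarith)
      _ ≤ N := hN
  -- `Λ = x^{1/40}`
  set Λ : ℝ := x ^ (1 / 40 : ℝ) with hΛdef
  have hΛ1 : 1 ≤ Λ := Real.one_le_rpow hx1 (by norm_num)
  have hΛ0 : 0 < Λ := by linarith
  have hΛpow : Λ ^ (n₀ - 1) = x ^ (3 : ℝ) := by
    rw [hΛdef, ← Real.rpow_natCast, ← Real.rpow_mul hx0.le, Nat.cast_sub (by omega : 1 ≤ n₀),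
      Nat.cast_one, hn₀eq]
  have hΛp0 : 0 < Λ ^ (n₀ - 1) := pow_pos hΛ0 _
  -- ### the objects
  set L₀ : ℕ := ⌊2 * S + Y⌋₊ with hL₀def
  have hL₀le : (L₀ : ℝ) ≤ 2 * S + Y := Nat.floor_le (by linarith)
  have hL₀3S : (L₀ : ℝ) ≤ 3 * S := by linarith
  have hL₀3x : (L₀ : ℝ) ≤ 3 * x := by linarith
  have h2SY : (2 : ℝ) ≤ 2 * S + Y := by linarith
  have hlogL₀ : Real.log L₀ ≤ 2 * L := by
    rcases Nat.eq_zero_or_pos L₀ with h0 | hpos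
    · rw [h0, Nat.cast_zero, Real.log_zero]; linarith
    · exact hlog2x L₀ (by exact_mod_cast hpos) hL₀3x
  have hlogL₀0 : 0 ≤ Real.log L₀ := Real.log_natCast_nonneg L₀
  have h𝒬pos : ∀ q ∈ (BFI.mRange S Y).filter (fun q : ℕ => 0 < q), 0 < q :=
    fun q hq => (Finset.mem_filter.1 hq).2
  have h𝒬sub : (BFI.mRange S Y).filter (fun q : ℕ => 0 < q) ⊆ Icc 1 L₀ := by
    intro q hq
    rw [Finset.mem_filter, BFI.mem_mRange] at hq
    rw [Finset.mem_Icc]; exact ⟨hq.2, hq.1⟩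
  have hγabs : ∀ q : ℕ, |BFI.bump S Y q| ≤ 1 := fun q => BFI.abs_bump_le_one hY0 hS0.le _
  have h𝒩sub : BFI.dyadic N ⊆ Ioc ⌊N⌋₊ (⌊N⌋₊ + (⌊N⌋₊ + 2)) := by
    intro n hn
    have h := (BFI.mem_dyadic hN0.le).1 hn
    rw [Finset.mem_Ioc]
    constructor
    · exact (Nat.floor_lt hN0.le).2 h.1
    · have h1 : (n : ℝ) ≤ 2 * N := h.2
      have h2 : N < ⌊N⌋₊ + 1 := Nat.lt_floor_add_one N
      have h3 : (n : ℝ) < 2 * ((⌊N⌋₊ : ℝ) + 1) := by linarith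
      have h4 : n < 2 * (⌊N⌋₊ + 1) := by exact_mod_cast h3
      omega
  -- weights for Cauchy–Schwarz
  have hM2 : (0 : ℝ) < M / 2 := by linarith
  have hw : ∀ m ∈ BFI.mRange M (M / 2), 0 ≤ BFI.bump M (M / 2) m :=
    fun m _ => (BFI.bump_mem_Icc hM2 hM0.le _).1
  have ht : ∀ m ∈ BFI.mRange M (M / 2), 0 ≤ (σ 0 m : ℝ) ^ Aτ := fun m _ => by positivity
  have hα' : ∀ m ∈ BFI.mRange M (M / 2), ‖(if m ∈ BFI.dyadic M then α m else 0)‖ ≤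
      (σ 0 m : ℝ) ^ Aτ * BFI.bump M (M / 2) m := by
    intro m _
    by_cases hm : m ∈ BFI.dyadic M
    · have h := (BFI.mem_dyadic hM0.le).1 hm
      rw [if_pos hm, BFI.bump_eq_one hM2 h.1.le h.2, mul_one]
      exact hα m
    · rw [if_neg hm, norm_zero]
      exact mul_nonneg (by positivity) (BFI.bump_mem_Icc hM2 hM0.le _).1
  have hA0 : 0 ≤ ∑ m ∈ BFI.mRange M (M / 2), BFI.bump M (M / 2) m := Finset.sum_nonneg hw
  have hA3M : ∑ m ∈ BFI.mRange M (M / 2), BFI.bump M (M / 2) m ≤ 3 * M := by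
    calc ∑ m ∈ BFI.mRange M (M / 2), BFI.bump M (M / 2) m ≤ ∑ m ∈ BFI.mRange M (M / 2), (1 : ℝ) :=
          Finset.sum_le_sum fun m _ => (BFI.bump_mem_Icc hM2 hM0.le _).2
      _ = (⌊2 * M + M / 2⌋₊ : ℝ) + 1 := by rw [Finset.sum_const, BFI.mRange, Finset.card_range]; simp
      _ ≤ 2 * M + M / 2 + 1 := by linarith [Nat.floor_le (show (0:ℝ) ≤ 2 * M + M / 2 by linarith)]
      _ ≤ 3 * M := by linarith
  -- ### divisor moments
  set Bs : ℝ := ∑ n ∈ Icc 1 ⌊2 * N⌋₊, (σ 0 n : ℝ) ^ r with hBsdef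
  have hBs : Bs ≤ CB * N * L ^ cd := by
    have h := hCdle (2 * N) (by linarith)
    have hlog : Real.log (2 * N) ≤ 2 * L := hlog2x _ (by linarith) (by linarith)
    have hlog0 : 0 ≤ Real.log (2 * N) := Real.log_nonneg (by linarith)
    calc Bs ≤ Cd * (2 * N) * Real.log (2 * N) ^ cd := h
      _ ≤ Cd * (2 * N) * (2 * L) ^ cd := by gcongr
      _ = CB * N * L ^ cd := by rw [hCBdef, mul_pow, pow_succ]; ring
  have hBs0 : 0 ≤ Bs := Finset.sum_nonneg fun _ _ => by positivity
  have hβ2 : ∑ n ∈ BFI.dyadic N, ‖β n‖ ^ 2 ≤ Bs := sum_dyadic_norm_sq_le hN0 hr hβ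
  have hβ1 : ∑ n ∈ (BFI.dyadic N).filter (fun n : ℕ => IsCoprime (n : ℤ) a₂), ‖β n‖ ≤ Bs :=
    sum_filter_dyadic_norm_le hN0 hrA hβ _
  have hβ10 : 0 ≤ ∑ n ∈ (BFI.dyadic N).filter (fun n : ℕ => IsCoprime (n : ℤ) a₂), ‖β n‖ :=
    Finset.sum_nonneg fun _ _ => norm_nonneg _
  set Qs : ℝ := ∑ q ∈ Icc 1 L₀, (σ 0 q : ℝ) ^ 4 / q with hQsdef
  have hQs : Qs ≤ CQ * L ^ 32 := by
    have h := hCqle (2 * S + Y) h2SY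
    have hlog : Real.log (2 * S + Y) ≤ 2 * L := hlog2x _ (by linarith) (by linarith)
    have hlog0 : 0 ≤ Real.log (2 * S + Y) := Real.log_nonneg (by linarith)
    calc Qs ≤ Cq * Real.log (2 * S + Y) ^ (2 ^ (4 + 1)) := h
      _ ≤ Cq * (2 * L) ^ (2 ^ (4 + 1)) := by gcongr
      _ = CQ * L ^ 32 := by rw [hCQdef, mul_pow]; norm_num; ring
  have hQs0 : 0 ≤ Qs := Finset.sum_nonneg fun _ _ => by positivity
  have hQ3 : ∑ q ∈ Icc 1 L₀, (σ 0 q : ℝ) ^ 3 / q ≤ Qs := by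
    refine Finset.sum_le_sum fun q hq => ?_
    have hq1 : 1 ≤ q := (Finset.mem_Icc.1 hq).1
    have hτ : (1 : ℝ) ≤ (σ 0 q : ℝ) := by exact_mod_cast one_le_sigma_zero (by omega)
    exact div_le_div_of_nonneg_right (pow_le_pow_right₀ hτ (by norm_num)) (Nat.cast_nonneg _)
  have hQ30 : 0 ≤ ∑ q ∈ Icc 1 L₀, (σ 0 q : ℝ) ^ 3 / q := Finset.sum_nonneg fun _ _ => by positivity
  have hF0 : ∑ m ∈ BFI.mRange M (M / 2), BFI.bump M (M / 2) m * ((σ 0 m : ℝ) ^ Aτ) ^ 2 ≤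
      CF * M * L ^ cd := by
    have h1 := sum_mRange_bump_mul_rpow_sq_le hM0 hr
    have h2 := hCdle (2 * M + M / 2) (by linarith)
    have hlog : Real.log (2 * M + M / 2) ≤ 2 * L := hlog2x _ (by linarith) (by linarith)
    have hlog0 : 0 ≤ Real.log (2 * M + M / 2) := Real.log_nonneg (by linarith)
    calc _ ≤ ∑ m ∈ Icc 1 ⌊2 * M + M / 2⌋₊, (σ 0 m : ℝ) ^ r := h1
      _ ≤ Cd * (2 * M + M / 2) * Real.log (2 * M + M / 2) ^ cd := h2
      _ ≤ Cd * (2 * M + M / 2) * (2 * L) ^ cd := by gcongr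
      _ = CF * M * L ^ cd := by rw [hCFdef, mul_pow]; ring
  -- ### the small arithmetic bounds (everything `≤ M N² / R²` up to constants and logs)
  set Bf : ℝ := ∑ n ∈ (BFI.dyadic N).filter (fun n : ℕ => IsCoprime (n : ℤ) a₂), ‖β n‖ with hBfdef
  set Q3 : ℝ := ∑ q ∈ Icc 1 L₀, (σ 0 q : ℝ) ^ 3 / q with hQ3def
  have hBf : Bf ^ 2 ≤ (CB * N * L ^ cd) ^ 2 := pow_le_pow_left₀ hβ10 (hβ1.trans hBs) 2
  have hBf' : Bf ≤ CB * N * L ^ cd := hβ1.trans hBs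
  have hQ3' : Q3 ≤ CQ * L ^ 32 := hQ3.trans hQs
  have hsmall3 : (R : ℝ) ^ 2 * Bf ^ 2 * (8 * Λ * R + cT) * Q3 ^ 2 ≤ M * N ^ 2 / (R : ℝ) ^ 2 := by
    have h2 : (8 * Λ * R + cT) ≤ (8 + cT) * (Λ * R) := by
      have h1 : cT * 1 ≤ cT * (Λ * R) :=
        mul_le_mul_of_nonneg_left (one_le_mul_of_one_le_of_one_le hΛ1 hR1') hcT0
      have e : (8 + cT) * (Λ * R) = 8 * Λ * R + cT * (Λ * R) := by ring
      rw [e]; rw [mul_one] at h1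
      linarith only [h1]
    have h5 : (8 + cT) * CB ^ 2 * CQ ^ 2 * L ^ (2 * cd + 64) ≤ x ^ (17 / 40 : ℝ) := hx₃ x hxx₃
    have h6 : (R : ℝ) ^ 3 * Λ * x ^ (17 / 40 : ℝ) ≤ M / (R : ℝ) ^ 2 := by
      rw [le_div_iff₀ (by positivity)]
      have hR5 : (R : ℝ) ^ 5 ≤ x ^ (1 / 20 : ℝ) := by
        calc (R : ℝ) ^ 5 ≤ (x ^ (1 / 100 : ℝ)) ^ 5 := pow_le_pow_left₀ hR0'.le hR100 5
          _ = x ^ (1 / 20 : ℝ) := by rw [← Real.rpow_natCast, ← Real.rpow_mul hx0.le]; norm_num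
      calc (R : ℝ) ^ 3 * Λ * x ^ (17 / 40 : ℝ) * (R : ℝ) ^ 2
          = (R : ℝ) ^ 5 * (Λ * x ^ (17 / 40 : ℝ)) := by ring
        _ ≤ x ^ (1 / 20 : ℝ) * (Λ * x ^ (17 / 40 : ℝ)) :=
            mul_le_mul_of_nonneg_right hR5 (by positivity)
        _ = x ^ (1 / 2 : ℝ) := by
            rw [hΛdef, ← Real.rpow_add hx0, ← Real.rpow_add hx0]; norm_num
        _ ≤ M := hMhalf
    calc (R : ℝ) ^ 2 * Bf ^ 2 * (8 * Λ * R + cT) * Q3 ^ 2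
        ≤ (R : ℝ) ^ 2 * (CB * N * L ^ cd) ^ 2 * ((8 + cT) * (Λ * R)) * (CQ * L ^ 32) ^ 2 := by
          gcongr
      _ = (R : ℝ) ^ 3 * Λ * N ^ 2 * ((8 + cT) * CB ^ 2 * CQ ^ 2 * L ^ (2 * cd + 64)) := by ring
      _ ≤ (R : ℝ) ^ 3 * Λ * N ^ 2 * x ^ (17 / 40 : ℝ) := mul_le_mul_of_nonneg_left h5 (by positivity)
      _ = ((R : ℝ) ^ 3 * Λ * x ^ (17 / 40 : ℝ)) * N ^ 2 := by ring
      _ ≤ (M / (R : ℝ) ^ 2) * N ^ 2 := mul_le_mul_of_nonneg_right h6 (by positivity)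
      _ = M * N ^ 2 / (R : ℝ) ^ 2 := by ring
  have hsmall2 : (R : ℝ) * Bf ^ 2 * L₀ * (8 * Λ * Real.sqrt R + cT) * Qs ≤ M * N ^ 2 / (R : ℝ) ^ 2 := by
    have hsqR1 : 1 ≤ Real.sqrt R := by rw [Real.le_sqrt' one_pos, one_pow]; exact hR1'
    have h2 : 8 * Λ * Real.sqrt R + cT ≤ (8 + cT) * (Λ * Real.sqrt R) := by
      have h1 : cT * 1 ≤ cT * (Λ * Real.sqrt R) :=
        mul_le_mul_of_nonneg_left (one_le_mul_of_one_le_of_one_le hΛ1 hsqR1) hcT0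
      have e : (8 + cT) * (Λ * Real.sqrt R) = 8 * Λ * Real.sqrt R + cT * (Λ * Real.sqrt R) := by ring
      rw [e]; rw [mul_one] at h1
      linarith only [h1]
    have h5 : 3 * (8 + cT) * CB ^ 2 * CQ * L ^ (2 * cd + 32) ≤ x ^ (9 / 100 : ℝ) := hx₂ x hxx₂
    have h6 : (R : ℝ) * Real.sqrt R * Λ * S * x ^ (9 / 100 : ℝ) ≤ M / (R : ℝ) ^ 2 := by
      rw [le_div_iff₀ (by positivity)]
      have hR72 : (R : ℝ) * Real.sqrt R * (R : ℝ) ^ 2 ≤ x ^ (7 / 200 : ℝ) := by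
        have e : (R : ℝ) * Real.sqrt R * (R : ℝ) ^ 2 = (R : ℝ) ^ (7 / 2 : ℝ) := by
          rw [Real.sqrt_eq_rpow, show (7 / 2 : ℝ) = 1 + 1 / 2 + 2 by norm_num,
            Real.rpow_add hR0', Real.rpow_add hR0', Real.rpow_one, Real.rpow_two]
        rw [e]
        calc (R : ℝ) ^ (7 / 2 : ℝ) ≤ (x ^ (1 / 100 : ℝ)) ^ (7 / 2 : ℝ) :=
              Real.rpow_le_rpow hR0'.le hR100 (by norm_num)
          _ = x ^ (7 / 200 : ℝ) := by rw [← Real.rpow_mul hx0.le]; norm_num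
      have hS51 : S ≤ x ^ (51 / 100 : ℝ) := hSx.trans (hmono (by linarith only [hδ1]))
      calc (R : ℝ) * Real.sqrt R * Λ * S * x ^ (9 / 100 : ℝ) * (R : ℝ) ^ 2
          = ((R : ℝ) * Real.sqrt R * (R : ℝ) ^ 2) * S * (Λ * x ^ (9 / 100 : ℝ)) := by ring
        _ ≤ x ^ (7 / 200 : ℝ) * x ^ (51 / 100 : ℝ) * (Λ * x ^ (9 / 100 : ℝ)) := by gcongr
        _ = x ^ (33 / 50 : ℝ) := by
            rw [hΛdef, ← Real.rpow_add hx0, ← Real.rpow_add hx0, ← Real.rpow_add hx0]; norm_num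
        _ ≤ M := hM66
    calc (R : ℝ) * Bf ^ 2 * L₀ * (8 * Λ * Real.sqrt R + cT) * Qs
        ≤ (R : ℝ) * (CB * N * L ^ cd) ^ 2 * (3 * S) * ((8 + cT) * (Λ * Real.sqrt R)) *
            (CQ * L ^ 32) := by gcongr
      _ = (R : ℝ) * Real.sqrt R * Λ * S * N ^ 2 *
            (3 * (8 + cT) * CB ^ 2 * CQ * L ^ (2 * cd + 32)) := by ring
      _ ≤ (R : ℝ) * Real.sqrt R * Λ * S * N ^ 2 * x ^ (9 / 100 : ℝ) :=
          mul_le_mul_of_nonneg_left h5 (by positivity)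
      _ = ((R : ℝ) * Real.sqrt R * Λ * S * x ^ (9 / 100 : ℝ)) * N ^ 2 := by ring
      _ ≤ (M / (R : ℝ) ^ 2) * N ^ 2 := mul_le_mul_of_nonneg_right h6 (by positivity)
      _ = M * N ^ 2 / (R : ℝ) ^ 2 := by ring
  have hsmall4 : (3 * M) * ((1 + Real.log L₀) ^ 4 *
      (2 * (((⌊N⌋₊ + 2 : ℕ) : ℝ) + 1) / (R : ℝ) ^ 2 + 6 + 4 * Real.log L₀) * Bs) ≤
      5346 * CB * (M * N ^ 2 * L ^ (cd + 5) / (R : ℝ) ^ 2) := by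
    have h2 : (1 + Real.log L₀) ^ 4 ≤ 81 * L ^ 4 := by
      calc (1 + Real.log L₀) ^ 4 ≤ (3 * L) ^ 4 :=
            pow_le_pow_left₀ (by positivity) (by linarith only [hlogL₀, hL1]) 4
        _ = 81 * L ^ 4 := by ring
    have h3 : 2 * (((⌊N⌋₊ + 2 : ℕ) : ℝ) + 1) / (R : ℝ) ^ 2 + 6 + 4 * Real.log L₀ ≤
        8 * N / (R : ℝ) ^ 2 + 14 * L := by
      have hfl : ((⌊N⌋₊ : ℕ) : ℝ) ≤ N := Nat.floor_le hN0.le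
      have h8 : 2 * (((⌊N⌋₊ + 2 : ℕ) : ℝ) + 1) ≤ 8 * N := by push_cast; linarith only [hfl, hN1]
      have := div_le_div_of_nonneg_right h8 (show (0:ℝ) ≤ (R : ℝ) ^ 2 by positivity)
      linarith only [this, hlogL₀, hL1]
    have h30 : 0 ≤ 2 * (((⌊N⌋₊ + 2 : ℕ) : ℝ) + 1) / (R : ℝ) ^ 2 + 6 + 4 * Real.log L₀ := by
      positivity
    have h6 : 14 * L ≤ 14 * L * (N / (R : ℝ) ^ 2) := by
      have : 1 ≤ N / (R : ℝ) ^ 2 := by rw [le_div_iff₀ (by positivity), one_mul]; exact hR2N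
      exact le_mul_of_one_le_right (by positivity) this
    calc (3 * M) * ((1 + Real.log L₀) ^ 4 *
          (2 * (((⌊N⌋₊ + 2 : ℕ) : ℝ) + 1) / (R : ℝ) ^ 2 + 6 + 4 * Real.log L₀) * Bs)
        ≤ (3 * M) * (81 * L ^ 4 * (8 * N / (R : ℝ) ^ 2 + 14 * L) * (CB * N * L ^ cd)) := by
          refine mul_le_mul_of_nonneg_left ?_ (by positivity)
          exact mul_le_mul (mul_le_mul h2 h3 h30 (by positivity)) hBs hBs0 (by positivity)
      _ ≤ (3 * M) * (81 * L ^ 4 * (8 * N / (R : ℝ) ^ 2 + 14 * L * (N / (R : ℝ) ^ 2)) *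
          (CB * N * L ^ cd)) := by gcongr
      _ = 243 * CB * (M * N ^ 2 / (R : ℝ) ^ 2) * (8 * L ^ (cd + 4) + 14 * L ^ (cd + 5)) := by ring
      _ ≤ 243 * CB * (M * N ^ 2 / (R : ℝ) ^ 2) * (22 * L ^ (cd + 5)) := by
          refine mul_le_mul_of_nonneg_left ?_ (by positivity)
          have : L ^ (cd + 4) ≤ L ^ (cd + 5) := pow_le_pow_right₀ hL1 (by omega)
          linarith only [this]
      _ = 5346 * CB * (M * N ^ 2 * L ^ (cd + 5) / (R : ℝ) ^ 2) := by ring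
  have hsmall1 : C₁ * M * N ^ 2 * Real.log x ^ c₁ / Rd ^ 2 ≤
      max C₁ 0 * (M * N ^ 2 * L ^ max c₁ 0 / (R : ℝ) ^ 2) := by
    have hLc : L ^ c₁ ≤ L ^ max c₁ 0 := Real.rpow_le_rpow_of_exponent_le hL1 (le_max_left _ _)
    have hRd2 : 1 / Rd ^ 2 ≤ 1 / (R : ℝ) ^ 2 :=
      one_div_le_one_div_of_le (by positivity) (pow_le_pow_left₀ hR0'.le hRRd 2)
    have h0 : 0 ≤ max C₁ 0 := le_max_right _ _
    calc C₁ * M * N ^ 2 * Real.log x ^ c₁ / Rd ^ 2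
        ≤ max C₁ 0 * M * N ^ 2 * L ^ c₁ / Rd ^ 2 := by gcongr; exact le_max_left _ _
      _ = max C₁ 0 * (M * N ^ 2 * L ^ c₁) * (1 / Rd ^ 2) := by ring
      _ ≤ max C₁ 0 * (M * N ^ 2 * L ^ max c₁ 0) * (1 / (R : ℝ) ^ 2) := by
          refine mul_le_mul (mul_le_mul_of_nonneg_left ?_ h0) hRd2 (by positivity) (by positivity)
          exact mul_le_mul_of_nonneg_left hLc (by positivity)
      _ = _ := by ring
  -- ### `𝒮₃` (5.16): character completion for the pairs `χ₁, χ₂` of small conductor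
  have hE₃ : ∀ q₁ ∈ ((BFI.mRange S Y).filter (fun q : ℕ => 0 < q)).filter
        (fun q : ℕ => IsCoprime (q : ℤ) (a₁ * a₂)),
      ∀ q₂ ∈ ((BFI.mRange S Y).filter (fun q : ℕ => 0 < q)).filter
        (fun q : ℕ => IsCoprime (q : ℤ) (a₁ * a₂)),
        ∀ χ₁ ∈ (univ.filter fun χ : DirichletCharacter ℂ q₁ => (χ.conductor : ℝ) ≤ R),
          ∀ χ₂ ∈ (univ.filter fun χ : DirichletCharacter ℂ q₂ => (χ.conductor : ℝ) ≤ R),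
            ‖∑ m ∈ BFI.mRange M (M / 2), ((BFI.bump M (M / 2) m : ℝ) : ℂ) *
                  (χ₁ (m : ZMod q₁) * (χ₂ (m : ZMod q₂))⁻¹) -
                ((∑ m ∈ BFI.mRange M (M / 2), BFI.bump M (M / 2) m : ℝ) : ℂ) / (Nat.lcm q₁ q₂ : ℂ) *
                  ∑ j ∈ Finset.range (Nat.lcm q₁ q₂), χ₁ (j : ZMod q₁) * (χ₂ (j : ZMod q₂))⁻¹‖ ≤
              8 * Λ * (σ 0 (Nat.lcm q₁ q₂) : ℝ) * R +
                2 ^ (n₀ + 3) * BFI.derivConst n₀ * (Nat.lcm q₁ q₂ : ℝ) / Λ ^ (n₀ - 1) := by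
    intro q₁ hq₁ q₂ hq₂ χ₁ hχ₁ χ₂ hχ₂
    have hq₁0 : 0 < q₁ := h𝒬pos q₁ (Finset.mem_filter.1 hq₁).1
    have hq₂0 : 0 < q₂ := h𝒬pos q₂ (Finset.mem_filter.1 hq₂).1
    exact completion_pair_bump_le hq₁0 hq₂0 χ₁ χ₂ hR0'.le (Finset.mem_filter.1 hχ₁).2
      (Finset.mem_filter.1 hχ₂).2 hM0 hΛ1 hn₀2
  have hlcm : ∀ q₁ ∈ (BFI.mRange S Y).filter (fun q : ℕ => 0 < q),
      ∀ q₂ ∈ (BFI.mRange S Y).filter (fun q : ℕ => 0 < q), (Nat.lcm q₁ q₂ : ℝ) ≤ Λ ^ (n₀ - 1) := by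
    intro q₁ hq₁ q₂ hq₂
    have hq₁' := Finset.mem_Icc.1 (h𝒬sub hq₁)
    have hq₂' := Finset.mem_Icc.1 (h𝒬sub hq₂)
    rw [hΛpow]
    have h1 : (Nat.lcm q₁ q₂ : ℝ) ≤ (q₁ : ℝ) * q₂ := by
      exact_mod_cast Nat.le_of_dvd (Nat.mul_pos hq₁'.1 hq₂'.1) (Nat.lcm_dvd_mul q₁ q₂)
    have h2 : (q₁ : ℝ) * q₂ ≤ (3 * x) * (3 * x) :=
      mul_le_mul (le_trans (by exact_mod_cast hq₁'.2) hL₀3x)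
        (le_trans (by exact_mod_cast hq₂'.2) hL₀3x) (Nat.cast_nonneg _) (by positivity)
    have h3 : (3 * x) * (3 * x) ≤ x ^ (3 : ℝ) := by
      rw [show x ^ (3 : ℝ) = x ^ (3 : ℕ) by rw [← Real.rpow_natCast]; norm_num]
      have := mul_le_mul_of_nonneg_right hx9 (sq_nonneg x)
      calc (3 * x) * (3 * x) = 9 * x ^ 2 := by ring
        _ ≤ x * x ^ 2 := this
        _ = x ^ 3 := by ring
    linarith only [h1, h2, h3]
  have htail : ∀ q₁ ∈ (BFI.mRange S Y).filter (fun q : ℕ => 0 < q),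
      ∀ q₂ ∈ (BFI.mRange S Y).filter (fun q : ℕ => 0 < q),
        2 ^ (n₀ + 3) * BFI.derivConst n₀ * (Nat.lcm q₁ q₂ : ℝ) / Λ ^ (n₀ - 1) ≤ cT := by
    intro q₁ hq₁ q₂ hq₂
    rw [hcTdef, div_le_iff₀ hΛp0]
    exact mul_le_mul_of_nonneg_left (hlcm q₁ hq₁ q₂ hq₂) (mul_nonneg (pow_nonneg zero_le_two _) hK0)
  have htail0 : ∀ q₁ q₂ : ℕ,
      0 ≤ 2 ^ (n₀ + 3) * BFI.derivConst n₀ * (Nat.lcm q₁ q₂ : ℝ) / Λ ^ (n₀ - 1) := fun q₁ q₂ =>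
    div_nonneg (mul_nonneg (mul_nonneg (pow_nonneg zero_le_two _) hK0) (Nat.cast_nonneg _)) hΛp0.le
  have hE3nn : ∀ q₁ q₂ : ℕ, 0 ≤ 8 * Λ * (σ 0 (Nat.lcm q₁ q₂) : ℝ) * R +
      2 ^ (n₀ + 3) * BFI.derivConst n₀ * (Nat.lcm q₁ q₂ : ℝ) / Λ ^ (n₀ - 1) := fun q₁ q₂ =>
    add_nonneg (by positivity) (htail0 q₁ q₂)
  have hE3le : ∀ q₁ ∈ (BFI.mRange S Y).filter (fun q : ℕ => 0 < q),
      ∀ q₂ ∈ (BFI.mRange S Y).filter (fun q : ℕ => 0 < q),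
        8 * Λ * (σ 0 (Nat.lcm q₁ q₂) : ℝ) * R +
            2 ^ (n₀ + 3) * BFI.derivConst n₀ * (Nat.lcm q₁ q₂ : ℝ) / Λ ^ (n₀ - 1) ≤
          (8 * Λ * R + cT) * (σ 0 q₁ : ℝ) * (σ 0 q₂ : ℝ) := by
    intro q₁ hq₁ q₂ hq₂
    have hq₁' := Finset.mem_Icc.1 (h𝒬sub hq₁)
    have hq₂' := Finset.mem_Icc.1 (h𝒬sub hq₂)
    have hσ := sigma_zero_lcm_le hq₁'.1 hq₂'.1
    have hσ1 : (1 : ℝ) ≤ (σ 0 q₁ : ℝ) := by exact_mod_cast one_le_sigma_zero (by omega)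
    have hσ2 : (1 : ℝ) ≤ (σ 0 q₂ : ℝ) := by exact_mod_cast one_le_sigma_zero (by omega)
    have hσσ : (1 : ℝ) ≤ (σ 0 q₁ : ℝ) * (σ 0 q₂ : ℝ) := one_le_mul_of_one_le_of_one_le hσ1 hσ2
    have hp : 0 ≤ 8 * Λ * R := by positivity
    have ht := htail q₁ hq₁ q₂ hq₂
    have i1 : 8 * Λ * (σ 0 (Nat.lcm q₁ q₂) : ℝ) * R ≤ 8 * Λ * R * ((σ 0 q₁ : ℝ) * (σ 0 q₂ : ℝ)) := by
      calc 8 * Λ * (σ 0 (Nat.lcm q₁ q₂) : ℝ) * R = 8 * Λ * R * (σ 0 (Nat.lcm q₁ q₂) : ℝ) := by ring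
        _ ≤ _ := mul_le_mul_of_nonneg_left hσ hp
    have i2 := ht.trans (le_mul_of_one_le_right hcT0 hσσ)
    calc _ ≤ 8 * Λ * R * ((σ 0 q₁ : ℝ) * (σ 0 q₂ : ℝ)) + cT * ((σ 0 q₁ : ℝ) * (σ 0 q₂ : ℝ)) :=
          add_le_add i1 i2
      _ = (8 * Λ * R + cT) * (σ 0 q₁ : ℝ) * (σ 0 q₂ : ℝ) := by ring
  have hS3 := norm_dispS3_sub_mul_mainX3_le' (R : ℝ) a₁ a₂ h𝒬pos (BFI.mRange M (M / 2))
    (BFI.dyadic N) (fun q : ℕ => BFI.bump S Y q) (fun m : ℕ => BFI.bump M (M / 2) m) β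
    (((∑ m ∈ BFI.mRange M (M / 2), BFI.bump M (M / 2) m : ℝ)) : ℂ) hE₃
  have hW3 := sum_pairs_S3_weights_le h𝒬sub (fun q : ℕ => IsCoprime (q : ℤ) (a₁ * a₂)) hγabs
    hR0'.le (B := Bf) (add_nonneg (by positivity) hcT0) hE3nn hE3le
  have hT3 := hS3.trans (hW3.trans hsmall3)
  -- ### `𝒮₂` (5.19): completion in a class modulo `q₁` against `χ₂`
  have hE₂ : ∀ q₁ ∈ ((BFI.mRange S Y).filter (fun q : ℕ => 0 < q)).filter
        (fun q : ℕ => IsCoprime (q : ℤ) (a₁ * a₂)),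
      ∀ q₂ ∈ ((BFI.mRange S Y).filter (fun q : ℕ => 0 < q)).filter
        (fun q : ℕ => IsCoprime (q : ℤ) (a₁ * a₂)),
        ∀ χ₂ ∈ (univ.filter fun χ : DirichletCharacter ℂ q₂ => (χ.conductor : ℝ) ≤ R),
          ∀ n₁ ∈ (BFI.dyadic N).filter (fun n : ℕ => IsCoprime (n : ℤ) a₂),
            ‖∑ m ∈ BFI.mRange M (M / 2), ((BFI.bump M (M / 2) m : ℝ) : ℂ) *
                  (if (m : ZMod q₁) * ((n₁ : ZMod q₁) * ((a₁ : ZMod q₁))⁻¹ * (a₂ : ZMod q₁)) = 1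
                    then χ₂ (m : ZMod q₂) else 0) -
                ((∑ m ∈ BFI.mRange M (M / 2), BFI.bump M (M / 2) m : ℝ) : ℂ) / (Nat.lcm q₁ q₂ : ℂ) *
                  ∑ j ∈ Finset.range (Nat.lcm q₁ q₂),
                    (if (j : ZMod q₁) * ((n₁ : ZMod q₁) * ((a₁ : ZMod q₁))⁻¹ * (a₂ : ZMod q₁)) = 1
                      then χ₂ (j : ZMod q₂) else 0)‖ ≤
              8 * Λ * (σ 0 (q₂ / Nat.gcd q₁ q₂) : ℝ) * (Nat.gcd q₁ q₂) * Real.sqrt R +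
                2 ^ (n₀ + 3) * BFI.derivConst n₀ * (Nat.lcm q₁ q₂ : ℝ) / Λ ^ (n₀ - 1) := by
    intro q₁ hq₁ q₂ hq₂ χ₂ hχ₂ n₁ _
    have hq₁0 : 0 < q₁ := h𝒬pos q₁ (Finset.mem_filter.1 hq₁).1
    have hq₂0 : 0 < q₂ := h𝒬pos q₂ (Finset.mem_filter.1 hq₂).1
    exact completion_class_bump_le hq₁0 hq₂0 _ χ₂ (Finset.mem_filter.1 hχ₂).2 hM0 hΛ1 hn₀2
  have hE2nn : ∀ q₁ q₂ : ℕ, 0 ≤ 8 * Λ * (σ 0 (q₂ / Nat.gcd q₁ q₂) : ℝ) * (Nat.gcd q₁ q₂) *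
      Real.sqrt R + 2 ^ (n₀ + 3) * BFI.derivConst n₀ * (Nat.lcm q₁ q₂ : ℝ) / Λ ^ (n₀ - 1) :=
    fun q₁ q₂ => add_nonneg (by positivity) (htail0 q₁ q₂)
  have hE2le : ∀ q₁ ∈ (BFI.mRange S Y).filter (fun q : ℕ => 0 < q),
      ∀ q₂ ∈ (BFI.mRange S Y).filter (fun q : ℕ => 0 < q),
        8 * Λ * (σ 0 (q₂ / Nat.gcd q₁ q₂) : ℝ) * (Nat.gcd q₁ q₂) * Real.sqrt R +
            2 ^ (n₀ + 3) * BFI.derivConst n₀ * (Nat.lcm q₁ q₂ : ℝ) / Λ ^ (n₀ - 1) ≤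
          8 * Λ * Real.sqrt R * (σ 0 q₂ : ℝ) * (Nat.gcd q₁ q₂ : ℝ) + cT := by
    intro q₁ hq₁ q₂ hq₂
    have hq₂' := Finset.mem_Icc.1 (h𝒬sub hq₂)
    have hσ := sigma_zero_div_gcd_le (q₁ := q₁) hq₂'.1
    have ht := htail q₁ hq₁ q₂ hq₂
    have hp : 0 ≤ 8 * Λ * Real.sqrt R * (Nat.gcd q₁ q₂ : ℝ) := by positivity
    have i1 : 8 * Λ * (σ 0 (q₂ / Nat.gcd q₁ q₂) : ℝ) * (Nat.gcd q₁ q₂) * Real.sqrt R ≤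
        8 * Λ * Real.sqrt R * (σ 0 q₂ : ℝ) * (Nat.gcd q₁ q₂ : ℝ) := by
      calc 8 * Λ * (σ 0 (q₂ / Nat.gcd q₁ q₂) : ℝ) * (Nat.gcd q₁ q₂) * Real.sqrt R
          = 8 * Λ * Real.sqrt R * (Nat.gcd q₁ q₂ : ℝ) * (σ 0 (q₂ / Nat.gcd q₁ q₂) : ℝ) := by ring
        _ ≤ 8 * Λ * Real.sqrt R * (Nat.gcd q₁ q₂ : ℝ) * (σ 0 q₂ : ℝ) :=
            mul_le_mul_of_nonneg_left hσ hp
        _ = _ := by ring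
    exact add_le_add i1 ht
  have hS2 := norm_dispS2_sub_mul_mainX3_le' (R : ℝ) a₁ a₂ h𝒬pos (BFI.mRange M (M / 2))
    (BFI.dyadic N) (fun q : ℕ => BFI.bump S Y q) (fun m : ℕ => BFI.bump M (M / 2) m) β
    (((∑ m ∈ BFI.mRange M (M / 2), BFI.bump M (M / 2) m : ℝ)) : ℂ) hE₂
  have hW2 := sum_pairs_S2_weights_le h𝒬sub (fun q : ℕ => IsCoprime (q : ℤ) (a₁ * a₂)) hγabs
    hR0'.le (B := Bf) (E₁ := 8 * Λ * Real.sqrt R) (by positivity) hcT0 hE2nn hE2le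
  have hT2 := hS2.trans (hW2.trans hsmall2)
  -- ### the main terms `X₁ − X₃` (§5.6) and `𝒮₁` (hypothesis)
  have hMT := norm_mainTermsDiff_le hR1 a₁ a₂ h𝒬sub h𝒩sub (fun q : ℕ => BFI.bump S Y q) hγabs β
  have hT4 := mul_le_mul hA3M (hMT.trans (mul_le_mul_of_nonneg_left hβ2 (by positivity)))
    (norm_nonneg _) (by positivity)
  have hT4' := hT4.trans hsmall4
  have hS1 := HC1 x hxx₁ M N S Rd Y hMN hN hNS hS (hSx.trans (hmono (by linarith only [hδ₁'])))
    hRd1 (hRd.trans (hmono hδ₁')) (le_trans (mul_le_mul_of_nonneg_left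
      (Real.rpow_le_rpow_of_exponent_le hx1 (by linarith only [hδ₁'])) hS0.le) hY1)
    hY4 a₁ a₂ ha₁ ha₂ (ha₁x.trans (hmono hδ₁')) (ha₂x.trans (hmono hδ₁')) β hβ hβs
  have hT1 := hS1.trans hsmall1
  -- ### Cauchy–Schwarz (5.10) and the bracket
  have h4 := norm_dispSum_sq_le_four_terms (R : ℝ) a₁ a₂ h𝒬pos (BFI.mRange M (M / 2))
    (BFI.dyadic N) (fun q : ℕ => BFI.bump S Y q) (fun m : ℕ => BFI.bump M (M / 2) m)
    (fun m : ℕ => (σ 0 m : ℝ) ^ Aτ) (fun m : ℕ => if m ∈ BFI.dyadic M then α m else 0) β hw ht hα'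
    hA0
  have hF00 : 0 ≤ ∑ m ∈ BFI.mRange M (M / 2), BFI.bump M (M / 2) m * ((σ 0 m : ℝ) ^ Aτ) ^ 2 :=
    Finset.sum_nonneg fun m hm => mul_nonneg (hw m hm) (sq_nonneg _)
  have hprod := h4.trans (bracket_le_aux hF0 hF00 hT1 hT2 hT3 hT4' (norm_nonneg _) (norm_nonneg _)
    (norm_nonneg _) (mul_nonneg hA0 (norm_nonneg _)))
  have hLcS : ∀ {e : ℝ}, e ≤ cS → L ^ e ≤ L ^ cS := fun h => Real.rpow_le_rpow_of_exponent_le hL1 h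
  have hLcS1 : 1 ≤ L ^ cS := Real.one_le_rpow hL1 hcS0
  have hbracket : max C₁ 0 * (M * N ^ 2 * L ^ max c₁ 0 / (R : ℝ) ^ 2) +
      2 * (M * N ^ 2 / (R : ℝ) ^ 2) + M * N ^ 2 / (R : ℝ) ^ 2 +
      5346 * CB * (M * N ^ 2 * L ^ (cd + 5) / (R : ℝ) ^ 2) ≤ CS * (M * N ^ 2 * L ^ cS / (R : ℝ) ^ 2) := by
    have e1 : M * N ^ 2 * L ^ max c₁ 0 / (R : ℝ) ^ 2 ≤ M * N ^ 2 * L ^ cS / (R : ℝ) ^ 2 :=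
      div_le_div_of_nonneg_right (mul_le_mul_of_nonneg_left (hLcS hcS1) (by positivity))
        (by positivity)
    have e2 : M * N ^ 2 * L ^ (cd + 5) / (R : ℝ) ^ 2 ≤ M * N ^ 2 * L ^ cS / (R : ℝ) ^ 2 := by
      refine div_le_div_of_nonneg_right (mul_le_mul_of_nonneg_left ?_ (by positivity))
        (by positivity)
      have : L ^ (cd + 5) = L ^ ((cd : ℝ) + 5) := by
        rw [← Real.rpow_natCast]; push_cast; ring_nf
      rw [this]
      exact hLcS hcS2
    have e3 : M * N ^ 2 / (R : ℝ) ^ 2 ≤ M * N ^ 2 * L ^ cS / (R : ℝ) ^ 2 := by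
      refine div_le_div_of_nonneg_right ?_ (by positivity)
      calc M * N ^ 2 = M * N ^ 2 * 1 := (mul_one _).symm
        _ ≤ M * N ^ 2 * L ^ cS := mul_le_mul_of_nonneg_left hLcS1 (by positivity)
    have h0 : 0 ≤ max C₁ 0 := le_max_right _ _
    have i1 := mul_le_mul_of_nonneg_left e1 h0
    have i2 := mul_le_mul_of_nonneg_left e2 (show (0:ℝ) ≤ 5346 * CB by positivity)
    calc _ ≤ max C₁ 0 * (M * N ^ 2 * L ^ cS / (R : ℝ) ^ 2) + 2 * (M * N ^ 2 * L ^ cS / (R : ℝ) ^ 2) +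
          (M * N ^ 2 * L ^ cS / (R : ℝ) ^ 2) + 5346 * CB * (M * N ^ 2 * L ^ cS / (R : ℝ) ^ 2) := by
          linarith only [i1, i2, e3]
      _ = CS * (M * N ^ 2 * L ^ cS / (R : ℝ) ^ 2) := by rw [hCSdef]; ring
  -- ### conclusion
  have hfin0 : 0 ≤ Real.sqrt (CF * CS) * x * L ^ (((cd : ℝ) + cS) / 2) / (R : ℝ) := by positivity
  have hsq : (CF * M * L ^ cd) * (CS * (M * N ^ 2 * L ^ cS / (R : ℝ) ^ 2)) =
      (Real.sqrt (CF * CS) * x * L ^ (((cd : ℝ) + cS) / 2) / (R : ℝ)) ^ 2 := by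
    rw [div_pow, mul_pow, mul_pow, Real.sq_sqrt (by positivity), ← hMN]
    have hL2 : (L ^ (((cd : ℝ) + cS) / 2)) ^ 2 = L ^ cd * L ^ cS := by
      rw [← Real.rpow_natCast, ← Real.rpow_mul hL0.le, ← Real.rpow_natCast L cd,
        ← Real.rpow_add hL0]
      congr 1; push_cast; ring
    rw [hL2]; ring
  have hfin2 := (hprod.trans (mul_le_mul_of_nonneg_left hbracket (by positivity))).trans_eq hsq
  have hfin := Real.sqrt_le_sqrt hfin2
  rw [Real.sqrt_sq (norm_nonneg _), Real.sqrt_sq hfin0] at hfin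
  rw [smoothSum_eq_dispSum hY0 hYS hM0 hRd0.le N a₁ a₂ α β]
  refine hfin.trans ?_
  rw [div_le_div_iff₀ hR0' hRd0]
  calc Real.sqrt (CF * CS) * x * L ^ (((cd : ℝ) + cS) / 2) * Rd
      ≤ Real.sqrt (CF * CS) * x * L ^ (((cd : ℝ) + cS) / 2) * (2 * R) :=
        mul_le_mul_of_nonneg_left hRd2R (by positivity)
    _ = 2 * Real.sqrt (CF * CS) * x * L ^ (((cd : ℝ) + cS) / 2) * R := by ring

end Drappeau2017

/-- **Drappeau 2017, Theorem 5.1 from the estimate for `𝒮₁`.**  If the dispersion sum `𝒮₁` of §5.3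
satisfies `|𝒮₁ − A₀ X₁| ≤ C M N² (log x)^c / Rd²` in the range of Theorem 5.1 (for the weights
`γ = BFI.bump S Y`, `α = BFI.bump M (M/2)`, `A₀ = ∑_m α(m)`, squarefree-supported `β` — this is
(5.11) for `𝒮₁`, proved in §5.4–5.5 of the paper from its Theorem 2.1), then Theorem 5.1 holds:
`Drappeau2017.prop53_of_S1` (§5.3, §5.6) followed by `Drappeau2017_theorem51_of_smooth_sqfree` (§5.2 and
the reduction to squarefree `n`). [cite: Drappeau2017, §5.2–5.6, Theorem 5.1] -/
theorem Drappeau2017_theorem51_of_S1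
    (HS1 : ∀ η : ℝ, 0 < η → ∃ δ : ℝ, 0 < δ ∧ ∀ Aτ : ℝ, 0 ≤ Aτ → ∃ C c₀ x₀ : ℝ, ∀ x : ℝ, x₀ ≤ x →
      ∀ M N S Rd Y : ℝ, M * N = x → x ^ η ≤ N → N ≤ S ^ (2 / 3 - η) → x ^ (1 / 4 : ℝ) ≤ S →
        S ≤ x ^ (1 / 2 + δ) → 1 ≤ Rd → Rd ≤ x ^ δ → S * x ^ (-δ) ≤ Y → Y ≤ S / 4 →
      ∀ a₁ a₂ : ℤ, a₁ ≠ 0 → a₂ ≠ 0 → (|a₁| : ℝ) ≤ x ^ δ → (|a₂| : ℝ) ≤ x ^ δ →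
      ∀ β : ℕ → ℂ, (∀ n, ‖β n‖ ≤ (σ 0 n : ℝ) ^ Aτ) → (∀ n, ¬Squarefree n → β n = 0) →
        ‖Drappeau2017.dispS1 a₁ a₂ ((BFI.mRange S Y).filter (fun q : ℕ => 0 < q))
              (BFI.mRange M (M / 2)) (BFI.dyadic N) (fun q : ℕ => BFI.bump S Y q)
              (fun m : ℕ => BFI.bump M (M / 2) m) β -
            ((∑ m ∈ BFI.mRange M (M / 2), BFI.bump M (M / 2) m : ℝ) : ℂ) *
              Drappeau2017.mainX1 a₁ a₂ ((BFI.mRange S Y).filter (fun q : ℕ => 0 < q))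
                (BFI.dyadic N) (fun q : ℕ => BFI.bump S Y q) β‖ ≤
          C * M * N ^ 2 * Real.log x ^ c₀ / Rd ^ 2) :
    Drappeau2017_theorem51 :=
  Drappeau2017_theorem51_of_smooth_sqfree (Drappeau2017.prop53_of_S1 HS1)

end Literature.NumberTheory.Sieve

end
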